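import Summits.QuantumFields.BalabanUV.T4Continuum.Support.NE3HessForm
import Summits.QuantumFields.BalabanUV.T4Continuum.Support.NE3PureGaugeFirstVariation
import Summits.QuantumFields.BalabanUV.T4Continuum.Support.NE7OneStepLetters
import Summits.QuantumFields.BalabanUV.T4Continuum.Support.NE3ProductPath
import HarnessLib

/-!
# NE7HessGaugeDir — THE HESSIAN OF THE WILSON ACTION IN A GAUGE DIRECTION: `hess V X (gaugeDir V ζ) F = −dAction V H′ F` with the COMMUTATOR FIELD
# `H′(x,κ) = Ad_{V(x,κ)⁻¹}ζ(x)·X(x,κ) − X(x,κ)·Ad_{V(x,κ)⁻¹}ζ(x)` — differentiate the exact invariance `dAction (Ve^{tX}) (gaugeDir (Ve^{tX}) ζ) = 0` in `t`; the letter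
# hHessGauge of road (B) (memo §7): the Hessian sees a gauge direction only through the FIRST variation, i.e. through the background's field strength; file 38

Cell `pub-balaban`, rung (B)+1 sub-cell t4, lineage `b2b-balaban-t4-ne7-p1` (CRUX PROVER NE7 #1 = OWNER of row NE7), generation 78; memo
`t4/b2b-balaban-t4-ne7-p1-g78/BUMP-CLASS-FLAT.md` §7.  File F107 (over `NE3HessForm.hasDerivAt_dAction_vary` (`d/dt|₀ dAction (Ve^{tX}) Y = hess V X Y`),
`NE3PureGaugeFirstVariation.dAction_gaugeDir` (`dAction W (gaugeDir W ζ) = 0` for EVERY `W`), `T4AveragingDeficitWall.hasDerivAt_hol_vary ∕ hasDerivAt_exp_smul_zero`).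
WHY (memo §7).  Road (B) carries an explicit finite pure-gauge field inside the expansion field of the (APE); its Hessian cross terms are controlled iff `hess_W(gauge direction, ·)`
is: by gauge invariance `t ↦ dAction (Ve^{tX}) (gaugeDir (Ve^{tX}) ζ)` vanishes identically, so `hess V X (gaugeDir V ζ) = d/dt|₀ dAction (Ve^{tX}) (gaugeDir V ζ)
= −d/dt|₀ dAction (Ve^{tX}) (gaugeDir (Ve^{tX}) ζ − gaugeDir V ζ)`, and the field `H_t := gaugeDir (Ve^{tX}) ζ − gaugeDir V ζ = e^{−tX}B₀e^{tX} − B₀` (`B₀ = Ad_{V⁻¹}ζ`; the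
`ζ(x+e_κ)` terms cancel) VANISHES at `t = 0` with derivative `B₀X − XB₀`: only that derivative survives the product rule.  The bound `|hess W (gaugeDir W ζ) Y F| ≤ C·x·‖ζ‖_∞·‖Y‖₁`
(`Re tr` of a commutator vanishes, `‖hol − 1‖ ≤ x`) is the successor's corollary.
WHAT ([folklore]; 0 def, 0 sorry).  §1 `gaugeDir_vary_sub`, `hasDerivAt_gaugeShift` (the field `H_t` and its derivative); §2 `hasDerivAt_mul_mul_of_zero` (product rule with a
vanishing middle factor), `hasDerivAt_curlAt_vary_gaugeShift`, `hasDerivAt_dwtAt_vary_gaugeShift`; §3 **`hess_gaugeDir_eq`**.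
HONEST FRAMING (page 1): exact matrix calculus, no inequality; nothing of Bałaban's asserted; (APE) NOT proved; NOT ONE-STEP, NOT NE7; spine 0∕9; finite T⁴ rung (B)+1 — NOT
infinite volume, NOT mass gap, NOT `BetaPertH`, NOT Clay.  Continuum YM on T⁴ ⇐ BetaPertH ∧ nine spine estimates (0/9 proved); BetaPertH ⇐ (D1) ∧ (D4) ∧ CAP+tail;
G-an2-4 gates asym, D1 and NE2/3/4.
-/

set_option autoImplicit false

open scoped BigOperators Matrix.Norms.L2Operator
open NormedSpace Finset

namespace Summit.QuantumFields.BalabanUV.T4Continuum.NE7HessGaugeDir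

open Literature.MathematicalPhysics.QuantumFieldTheory.Balaban1983to89
open B7Prop1Explicit B7Prop2Explicit UnitaryModel
open T4AveragingDeficitWall hiding Site Plane Plaq Bond
open BlockAveragePushDirGauge (gaugeDir)
open NE3HessForm (hess hessPlaq dAction hasDerivAt_dAction_vary)
open NE3PureGaugeFirstVariation (dAction_gaugeDir curl_add)
open AveragingDeficitTransport (Ad_mem_skewAdjoint norm_Ad_of_unitary)
open NE3ProductPath (commutator_mem_skewAdjoint)
open NE7OneStepLetters (abs_dAction_le_radius_mul)
open NE3HessBounds (norm_curlAt_le)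

noncomputable section

variable {d : ℕ} {n : Type*} [Fintype n] [DecidableEq n]

/-! ## §1 The gauge-direction shift `H_t = gaugeDir (Ve^{tX}) ζ − gaugeDir V ζ` and its derivative -/

/-- `gaugeDir (Ve^{tX}) ζ − gaugeDir V ζ = Ad_{(Ve^{tX})⁻¹}ζ − Ad_{V⁻¹}ζ` bondwise (the `ζ(x+e_κ)` terms cancel). [folklore] -/
theorem gaugeDir_vary_sub (V : Site d → Fin d → (Matrix n n ℂ)ˣ) (X : Site d → Fin d → Matrix n n ℂ) (ζ : Site d → Matrix n n ℂ) (t : ℝ)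
    (x : Site d) (κ : Fin d) :
    gaugeDir (vary V X t) ζ x κ - gaugeDir V ζ x κ = Ad (vary V X t x κ)⁻¹ (ζ x) - Ad (V x κ)⁻¹ (ζ x) := by
  simp only [gaugeDir]; abel

/-- **`d/dt|₀ (Ad_{(V(b)e^{tX})⁻¹}B − Ad_{V(b)⁻¹}B) = B₀X − XB₀`**, `B₀ = Ad_{V(b)⁻¹}B`, and the shift vanishes at `t = 0`. [folklore] -/
theorem hasDerivAt_gaugeShift (A : (Matrix n n ℂ)ˣ) (X B : Matrix n n ℂ) :
    HasDerivAt (fun t : ℝ => Ad (A * expUnit ((t : ℂ) • X))⁻¹ B - Ad A⁻¹ B) (Ad A⁻¹ B * X - X * Ad A⁻¹ B) 0 := by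
  have h1 := (hasDerivAt_exp_neg_smul_zero X).mul_const (Ad A⁻¹ B)
  have h2 := h1.mul (hasDerivAt_exp_smul_zero X)
  have h3 : HasDerivAt (fun t : ℝ => exp (-((t : ℂ) • X)) * Ad A⁻¹ B * exp ((t : ℂ) • X) - Ad A⁻¹ B)
      (-X * Ad A⁻¹ B * exp (((0 : ℝ) : ℂ) • X) + exp (-(((0 : ℝ) : ℂ) • X)) * Ad A⁻¹ B * X) 0 := h2.sub_const _
  have h4 : HasDerivAt (fun t : ℝ => Ad (A * expUnit ((t : ℂ) • X))⁻¹ B - Ad A⁻¹ B)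
      (-X * Ad A⁻¹ B * exp (((0 : ℝ) : ℂ) • X) + exp (-(((0 : ℝ) : ℂ) • X)) * Ad A⁻¹ B * X) 0 := by
    refine h3.congr_of_eventuallyEq (Filter.Eventually.of_forall fun t => ?_)
    simp only [Ad, mul_inv_rev, inv_inv, Units.val_mul, val_inv_expUnit, val_expUnit, neg_neg, mul_assoc]
  refine h4.congr_deriv ?_
  simp only [Complex.ofReal_zero, zero_smul, neg_zero, exp_zero, mul_one, one_mul, neg_mul]
  abel

/-! ## §2 Product rule with a vanishing middle factor; the curl and the density along the shift -/

/-- If `y 0 = 0` then `d/dt|₀ (p·y·q) = p(0)·y′·q(0)`. [folklore] -/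
theorem hasDerivAt_mul_mul_of_zero {p q y : ℝ → Matrix n n ℂ} {p' q' y' : Matrix n n ℂ} (hp : HasDerivAt p p' 0) (hq : HasDerivAt q q' 0)
    (hy : HasDerivAt y y' 0) (hy0 : y 0 = 0) : HasDerivAt (fun t => p t * y t * q t) (p 0 * y' * q 0) 0 := by
  have h := (hp.mul hy).mul hq
  refine h.congr_deriv ?_
  simp only [Pi.mul_apply, hy0, mul_zero, zero_add, zero_mul, add_zero]

/-- The three varied bond factors and their inverses are differentiable in `t` (values irrelevant below). [folklore] -/
theorem hasDerivAt_val_vary (A : (Matrix n n ℂ)ˣ) (X : Matrix n n ℂ) :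
    HasDerivAt (fun t : ℝ => ((A * expUnit ((t : ℂ) • X) : (Matrix n n ℂ)ˣ) : Matrix n n ℂ)) ((A : Matrix n n ℂ) * X) 0 := by
  have h := (hasDerivAt_exp_smul_zero X).const_mul (A : Matrix n n ℂ)
  refine h.congr_of_eventuallyEq (Filter.Eventually.of_forall fun t => ?_)
  simp only [Units.val_mul, val_expUnit]

/-- Inverse factor. [folklore] -/
theorem hasDerivAt_val_vary_inv (A : (Matrix n n ℂ)ˣ) (X : Matrix n n ℂ) :
    HasDerivAt (fun t : ℝ => (((A * expUnit ((t : ℂ) • X))⁻¹ : (Matrix n n ℂ)ˣ) : Matrix n n ℂ)) (-X * ((A⁻¹ : (Matrix n n ℂ)ˣ) : Matrix n n ℂ)) 0 := by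
  have h := (hasDerivAt_exp_neg_smul_zero X).mul_const ((A⁻¹ : (Matrix n n ℂ)ˣ) : Matrix n n ℂ)
  refine h.congr_of_eventuallyEq (Filter.Eventually.of_forall fun t => ?_)
  simp only [mul_inv_rev, Units.val_mul, val_inv_expUnit, val_expUnit]

/-- **THE CURL ALONG THE SHIFT**: with `H_t := gaugeDir (Ve^{tX}) ζ − gaugeDir V ζ` and `H′(x,κ) := Ad_{V(x,κ)⁻¹}ζ(x)·X(x,κ) − X(x,κ)·Ad_{V(x,κ)⁻¹}ζ(x)`:
`d/dt|₀ curlAt (Ve^{tX}) H_t (z;μ,ν) = curlAt V H′ (z;μ,ν)`. [folklore] -/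
theorem hasDerivAt_curlAt_vary_gaugeShift (V : Site d → Fin d → (Matrix n n ℂ)ˣ) (X : Site d → Fin d → Matrix n n ℂ) (ζ : Site d → Matrix n n ℂ)
    (z : Site d) (μ ν : Fin d) :
    HasDerivAt (fun t : ℝ => curlAt (vary V X t) (fun x κ => gaugeDir (vary V X t) ζ x κ - gaugeDir V ζ x κ) z μ ν)
      (curlAt V (fun x κ => Ad (V x κ)⁻¹ (ζ x) * X x κ - X x κ * Ad (V x κ)⁻¹ (ζ x)) z μ ν) 0 := by
  -- the shift at the four bonds of the plaquette
  have hH : ∀ (x : Site d) (κ : Fin d), HasDerivAt (fun t : ℝ => gaugeDir (vary V X t) ζ x κ - gaugeDir V ζ x κ)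
      (Ad (V x κ)⁻¹ (ζ x) * X x κ - X x κ * Ad (V x κ)⁻¹ (ζ x)) 0 := by
    intro x κ
    refine (hasDerivAt_gaugeShift (V x κ) (X x κ) (ζ x)).congr_of_eventuallyEq (Filter.Eventually.of_forall fun t => ?_)
    show gaugeDir (vary V X t) ζ x κ - gaugeDir V ζ x κ = Ad (V x κ * expUnit ((t : ℂ) • X x κ))⁻¹ (ζ x) - Ad (V x κ)⁻¹ (ζ x)
    rw [gaugeDir_vary_sub]; rfl
  have hH0 : ∀ (x : Site d) (κ : Fin d), (fun t : ℝ => gaugeDir (vary V X t) ζ x κ - gaugeDir V ζ x κ) 0 = 0 := by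
    intro x κ; simp only [vary_zero]; exact sub_self _
  -- the varied bond factors (as matrices) and their inverses are differentiable
  have Ha := hasDerivAt_val_vary (V z μ) (X z μ)
  have Hai := hasDerivAt_val_vary_inv (V z μ) (X z μ)
  have Hb := hasDerivAt_val_vary (V (z + e μ) ν) (X (z + e μ) ν)
  have Hbi := hasDerivAt_val_vary_inv (V (z + e μ) ν) (X (z + e μ) ν)
  have Hc := hasDerivAt_val_vary (V (z + e ν) μ) (X (z + e ν) μ)
  have Hci := hasDerivAt_val_vary_inv (V (z + e ν) μ) (X (z + e ν) μ)
  -- the four terms of the curl: `Ad_{P(t)} H_t(b) = P(t)·H_t(b)·P(t)⁻¹`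
  have T1 := hasDerivAt_mul_mul_of_zero Ha Hai (hH z μ) (hH0 z μ)
  have T2 := hasDerivAt_mul_mul_of_zero (Ha.mul Hb) (Hbi.mul Hai) (hH (z + e μ) ν) (hH0 (z + e μ) ν)
  have T3 := hasDerivAt_mul_mul_of_zero (Ha.mul Hb) (Hbi.mul Hai) (hH (z + e ν) μ) (hH0 (z + e ν) μ)
  have T4 := hasDerivAt_mul_mul_of_zero ((Ha.mul Hb).mul Hci) ((Hc.mul Hbi).mul Hai) (hH z ν) (hH0 z ν)
  have H := ((T1.add T2).sub T3).sub T4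
  refine (H.congr_of_eventuallyEq (Filter.Eventually.of_forall fun t => ?_)).congr_deriv ?_
  · simp only [Pi.add_apply, Pi.sub_apply, Pi.mul_apply, curlAt, vary, Ad, Units.val_mul, mul_inv_rev, inv_inv, val_expUnit, val_inv_expUnit,
      neg_neg, mul_assoc]
  · simp only [Pi.mul_apply, curlAt, Ad, Units.val_mul, mul_inv_rev, inv_inv, val_expUnit, val_inv_expUnit, Complex.ofReal_zero, zero_smul,
      neg_zero, exp_zero, mul_one, one_mul, mul_assoc]

/-- **THE FIRST-VARIATION DENSITY ALONG THE SHIFT**: `d/dt|₀ Re tr[curlAt (Ve^{tX}) H_t (p′)·hol_{Ve^{tX}}(∂p′)] = Re tr[curlAt V H′ (p′)·hol_V(∂p′)]`. [folklore] -/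
theorem hasDerivAt_dwtAt_vary_gaugeShift (V : Site d → Fin d → (Matrix n n ℂ)ˣ) (X : Site d → Fin d → Matrix n n ℂ) (ζ : Site d → Matrix n n ℂ)
    (z : Site d) (μ ν : Fin d) :
    HasDerivAt (fun t : ℝ => nReTr (curlAt (vary V X t) (fun x κ => gaugeDir (vary V X t) ζ x κ - gaugeDir V ζ x κ) z μ ν
        * ((hol (vary V X t) z (plaqWord μ ν) : (Matrix n n ℂ)ˣ) : Matrix n n ℂ)))
      (nReTr (curlAt V (fun x κ => Ad (V x κ)⁻¹ (ζ x) * X x κ - X x κ * Ad (V x κ)⁻¹ (ζ x)) z μ ν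
        * ((hol V z (plaqWord μ ν) : (Matrix n n ℂ)ˣ) : Matrix n n ℂ))) 0 := by
  have h0 : curlAt (vary V X 0) (fun x κ => gaugeDir (vary V X 0) ζ x κ - gaugeDir V ζ x κ) z μ ν = 0 := by
    simp only [vary_zero, sub_self, curlAt, Ad, mul_zero, zero_mul, add_zero, sub_self]
  have h := (hasDerivAt_curlAt_vary_gaugeShift V X ζ z μ ν).mul (hasDerivAt_hol_vary V X z μ ν)
  have h2 := (nReTrL (n := n)).hasFDerivAt.comp_hasDerivAt (0 : ℝ) h
  refine (h2.congr_of_eventuallyEq (Filter.Eventually.of_forall fun t => ?_)).congr_deriv ?_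
  · simp only [Function.comp_apply, Pi.mul_apply, nReTrL_apply]
  · rw [h0, zero_mul, add_zero, vary_zero, nReTrL_apply]

/-! ## §3 The Hessian in a gauge direction -/

/-- **THE HESSIAN OF THE WILSON ACTION IN A GAUGE DIRECTION** (every background `V`, every window `F`):
`hess V X (gaugeDir V ζ) F = −dAction V H′ F`, `H′(x,κ) = Ad_{V(x,κ)⁻¹}ζ(x)·X(x,κ) − X(x,κ)·Ad_{V(x,κ)⁻¹}ζ(x)` — i.e. `= Σ_{p∈F} Re tr[curl_V H′(p)·hol_V(∂p)]`,
the FIRST variation in a commutator direction. [folklore] -/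
theorem hess_gaugeDir_eq (V : Site d → Fin d → (Matrix n n ℂ)ˣ) (X : Site d → Fin d → Matrix n n ℂ) (ζ : Site d → Matrix n n ℂ) (F : Finset (T4AveragingDeficitWall.Plaq d)) :
    hess V X (gaugeDir V ζ) F = -dAction V (fun x κ => Ad (V x κ)⁻¹ (ζ x) * X x κ - X x κ * Ad (V x κ)⁻¹ (ζ x)) F := by
  -- `g(t) := dAction (Ve^{tX}) (gaugeDir V ζ) F` has derivative `hess` at `0` …
  have hg := hasDerivAt_dAction_vary V X (gaugeDir V ζ) F
  -- … and equals `Σ_p Re tr[curl_{V_t} H_t (p) hol_{V_t}(∂p)]` by the exact invariance at `V_t`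
  have hgeq : ∀ t : ℝ, dAction (vary V X t) (gaugeDir V ζ) F
      = ∑ p ∈ F, nReTr (curlAt (vary V X t) (fun x κ => gaugeDir (vary V X t) ζ x κ - gaugeDir V ζ x κ) p.1 p.2.1.1 p.2.1.2
          * ((hol (vary V X t) p.1 (plaqWord p.2.1.1 p.2.1.2) : (Matrix n n ℂ)ˣ) : Matrix n n ℂ)) := by
    intro t
    have hinv := dAction_gaugeDir (vary V X t) ζ F
    have e1 : dAction (vary V X t) (gaugeDir V ζ) F = dAction (vary V X t) (gaugeDir V ζ) F - dAction (vary V X t) (gaugeDir (vary V X t) ζ) F := by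
      rw [hinv, sub_zero]
    rw [e1]
    simp only [dAction, ← Finset.sum_neg_distrib, ← Finset.sum_sub_distrib]
    refine Finset.sum_congr rfl fun p _ => ?_
    rw [sub_neg_eq_add, neg_add_eq_sub, ← T4TiltOscillation.nReTr_sub, ← sub_mul, NE3CurlOfGaugeDir.curlAt_sub]
    rfl
  have hsum := HasDerivAt.sum (u := F) (x := (0 : ℝ))
    (A := fun p t => nReTr (curlAt (vary V X t) (fun x κ => gaugeDir (vary V X t) ζ x κ - gaugeDir V ζ x κ) p.1 p.2.1.1 p.2.1.2
          * ((hol (vary V X t) p.1 (plaqWord p.2.1.1 p.2.1.2) : (Matrix n n ℂ)ˣ) : Matrix n n ℂ)))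
    (A' := fun p => nReTr (curlAt V (fun x κ => Ad (V x κ)⁻¹ (ζ x) * X x κ - X x κ * Ad (V x κ)⁻¹ (ζ x)) p.1 p.2.1.1 p.2.1.2
          * ((hol V p.1 (plaqWord p.2.1.1 p.2.1.2) : (Matrix n n ℂ)ˣ) : Matrix n n ℂ)))
    fun p _ => hasDerivAt_dwtAt_vary_gaugeShift V X ζ p.1 p.2.1.1 p.2.1.2
  have hsum' : HasDerivAt (fun t : ℝ => dAction (vary V X t) (gaugeDir V ζ) F)
      (∑ p ∈ F, nReTr (curlAt V (fun x κ => Ad (V x κ)⁻¹ (ζ x) * X x κ - X x κ * Ad (V x κ)⁻¹ (ζ x)) p.1 p.2.1.1 p.2.1.2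
          * ((hol V p.1 (plaqWord p.2.1.1 p.2.1.2) : (Matrix n n ℂ)ˣ) : Matrix n n ℂ))) 0 := by
    have h' : HasDerivAt (fun t : ℝ => ∑ p ∈ F, nReTr (curlAt (vary V X t) (fun x κ => gaugeDir (vary V X t) ζ x κ - gaugeDir V ζ x κ) p.1 p.2.1.1 p.2.1.2
          * ((hol (vary V X t) p.1 (plaqWord p.2.1.1 p.2.1.2) : (Matrix n n ℂ)ˣ) : Matrix n n ℂ)))
        (∑ p ∈ F, nReTr (curlAt V (fun x κ => Ad (V x κ)⁻¹ (ζ x) * X x κ - X x κ * Ad (V x κ)⁻¹ (ζ x)) p.1 p.2.1.1 p.2.1.2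
          * ((hol V p.1 (plaqWord p.2.1.1 p.2.1.2) : (Matrix n n ℂ)ˣ) : Matrix n n ℂ))) 0 := by
      simpa [Finset.sum_fn] using hsum
    exact h'.congr_of_eventuallyEq (Filter.Eventually.of_forall fun t => hgeq t)
  have huniq := hg.unique hsum'
  rw [huniq]
  simp only [dAction, neg_neg]
  rfl

/-! ## §4 The bound: the Hessian sees a gauge direction only through the field strength -/

/-- **hHessGauge, THE BOUND**: for unitary `V` with plaquette radius `a`, skew `X`, skew `ζ`:
`|hess V X (gaugeDir V ζ) F| ≤ a·Σ_{p∈F} ‖curl_V H′(p)‖` with `‖H′(x,κ)‖ ≤ 2‖ζ(x)‖‖X(x,κ)‖` — the commutator field is skew, so its first variation vanishes against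
`1` and only `hol − 1` (`≤ a`) contributes (`NE7OneStepLetters.abs_dAction_le_radius_mul`). [folklore] -/
theorem abs_hess_gaugeDir_le [Nonempty n] {V : Site d → Fin d → (Matrix n n ℂ)ˣ} (hV : IsUnitaryCfg V) {a : ℝ} (hVa : SmallField V a)
    {X : Site d → Fin d → Matrix n n ℂ} (hX : IsSkewDir X) {ζ : Site d → Matrix n n ℂ} (hζ : ∀ x, ζ x ∈ skewAdjoint (Matrix n n ℂ))
    (F : Finset (T4AveragingDeficitWall.Plaq d)) :
    |hess V X (gaugeDir V ζ) F| ≤ a * ∑ p ∈ F, ‖curl V (fun x κ => Ad (V x κ)⁻¹ (ζ x) * X x κ - X x κ * Ad (V x κ)⁻¹ (ζ x)) p‖ := by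
  rw [hess_gaugeDir_eq, abs_neg]
  have hH : IsSkewDir (fun x κ => Ad (V x κ)⁻¹ (ζ x) * X x κ - X x κ * Ad (V x κ)⁻¹ (ζ x)) := fun x κ =>
    commutator_mem_skewAdjoint (Ad_mem_skewAdjoint ((unitaryUnits _).inv_mem (hV x κ)) (hζ x)) (hX x κ)
  exact abs_dAction_le_radius_mul hV hH hVa F

/-- The commutator field is small with its data: `‖H′(x,κ)‖ ≤ 2‖ζ(x)‖·‖X(x,κ)‖`; hence `‖curl_V H′(p)‖ ≤` the sum of `2‖ζ‖‖X‖` over the four bonds of `p`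
(`NE3HessBounds.norm_curlAt_le`). [folklore] -/
theorem norm_commutatorField_le {V : Site d → Fin d → (Matrix n n ℂ)ˣ} (hV : IsUnitaryCfg V) (X : Site d → Fin d → Matrix n n ℂ) (ζ : Site d → Matrix n n ℂ)
    (x : Site d) (κ : Fin d) : ‖Ad (V x κ)⁻¹ (ζ x) * X x κ - X x κ * Ad (V x κ)⁻¹ (ζ x)‖ ≤ 2 * ‖ζ x‖ * ‖X x κ‖ := by
  have hB : ‖Ad (V x κ)⁻¹ (ζ x)‖ = ‖ζ x‖ := norm_Ad_of_unitary ((unitaryUnits _).inv_mem (hV x κ)) _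
  calc ‖Ad (V x κ)⁻¹ (ζ x) * X x κ - X x κ * Ad (V x κ)⁻¹ (ζ x)‖
      ≤ ‖Ad (V x κ)⁻¹ (ζ x) * X x κ‖ + ‖X x κ * Ad (V x κ)⁻¹ (ζ x)‖ := norm_sub_le _ _
    _ ≤ ‖Ad (V x κ)⁻¹ (ζ x)‖ * ‖X x κ‖ + ‖X x κ‖ * ‖Ad (V x κ)⁻¹ (ζ x)‖ := add_le_add (norm_mul_le _ _) (norm_mul_le _ _)
    _ = 2 * ‖ζ x‖ * ‖X x κ‖ := by rw [hB]; ring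

end

end Summit.QuantumFields.BalabanUV.T4Continuum.NE7HessGaugeDir
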